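/-
Copyright (c) 2026 the pub-hodgecm-mathlib formalisation cell (harness21).  Prover seat hodgecm-mathlib-F0P3a-p01 (g16): road «S3-ram» (LEAD F0P3a-plan (g12); architect
A-p16 (g31) 22:33:05Z «(1) FIXED-CHILD CRITERION GO»; owner F0P3a-p06 (g15)), organ A′ (ii) «the inductive step of every fixed-lattice count»; 2026-09-01.
-/
import Literature.NumberTheory.Automorphic.UnitaryLatticeTreeFixedCostarCoordsRamified   -- ★ (F0P3a-p07 (g11)): `mapGL_N₁_sup_span_vec_eq_iff_of_v` (the σϖ-free costar test in coordinates)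
import Literature.NumberTheory.Automorphic.UnitaryLatticeTreeFixedStar                  -- ★ T2-E′ (B-p14 (g35)): `mapGL_mul_N₁_eq_iff`, `mapGL_mul_N₁_eq_of_congr_one` (the fixed-star test at `L₀`)
import HarnessLib

/-!
# The lattice graph of a hermitian space — THE FIXED-CHILD CRITERION: when does an element of a vertex stabiliser fix a self-dual lattice at distance two?
# (Bruhat–Tits 1972 §10; Tits 1979 §3.5; Serre, *Trees* II.1.1)

Topic `NumberTheory/Automorphic`; namespace `Literature.NumberTheory.Automorphic.UnitaryLatticeTree`.  THEOREMS ONLY (no definition, no instance, no notation, no named fact,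
no `sorry`); kernel lane `--supports stmt-HodgeConjecture-24833`.  Cell `pub/hodgecm-mathlib` (D-0151), crux H413; road «S3-ram» (Literature seeding), organ A′ (ii) of the
P-1-ram skeleton (architect A-p16 (g31)): the INDUCTIVE STEP on which every closed-form count of `t`-fixed self-dual lattices rests (the «O(1) residual fixed test» of the
certificate engines `p1ram_t0.py` ∕ `gfast.py`, CERT smoke v1 §4 (2)), in the ★ `UnitaryLatticeTree*` vocabulary and DATUM-FREE (`K` with `Valued K ℤᵐ⁰`, `σ` valuation-
preserving, `ϖ` a uniformiser; `J₀ = antidiag(1,1,1)`, `L₀ = 𝒪³`, `N₁ = latt diag(1,1,ϖ)` the standard type-two neighbour, `K₀ = U(σ,J₀) ∩ GL₃(𝒪)` = ★ `unitaryInt`).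
Rooted at `L₀`, the vertices at distance two through the type-two neighbour `κ·N₁` (`κ ∈ K₀`, isotropic vector `x = κe₀`) are the `κ·(N₁ ⊔ 𝒪·w(a,b))`, `w(a,b) = (a∕ϖ, 0, b)`,
`|a| = 1` (at a TAMELY RAMIFIED place these `q` lattices, `b mod 𝔪`, are ALL the self-dual neighbours of `κ·N₁` other than `L₀`: ★ `mem_neighborSet_N₁_iff_exists_vec_of_neg` +
★ `isSelfDualLattice_N₁_sup_span_vec_of_neg`; at an inert place an isotropy condition cuts them down — the criterion below is the same).

THE CRITERION (σϖ-FREE).  For `γ ∈ K₀` with `γ·N₁ = N₁` (so `γ₂₀, γ₂₁ ∈ 𝔪` and `γ₀₀ ∈ 𝒪^×`, §1):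
  **`γ·(N₁ ⊔ 𝒪w(a,b)) = N₁ ⊔ 𝒪w(a,b) ↔ |ϖ⁻¹γ₂₀·a + (γ₂₂ − γ₀₀)·b| < 1`** (§2 `mapGL_N₁_sup_span_vec_eq_iff_v_lt`)
— ONE residual LINEAR condition on the lift `b` (★ `mapGL_N₁_sup_span_vec_eq_iff_of_v` with its unit `c` pinned to `γ₀₀`); when the two corner residues agree
(`|γ₂₂ − γ₀₀| < 1`, e.g. `γ` RESIDUALLY UNIPOTENT — every vertex met by a deep class) it is LIFT-FREE: `↔ |ϖ⁻¹·γ₂₀| < 1` (`…_of_v_sub_lt`, and through `κ·N₁`: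
`↔ |ϖ⁻¹·B₀(x, γx)| < 1`, `mapGL_mapGL_N₁_sup_span_vec_eq_iff_of_v_sub_lt`).  DEEP ELEMENTS (§3): if `γ ≡ 1 (mod ϖ)` entrywise
then `γ·N₁ = N₁` is automatic (★ `mapGL_mul_N₁_eq_of_congr_one`) and the criterion collapses to **`|γ₂₀| < |ϖ|`, INDEPENDENT OF `(a, b)`** («the `q` lifts are fixed together»,
`mapGL_N₁_sup_span_vec_eq_iff_of_congr`); if `γ ≡ 1 (mod ϖ²)` every child is fixed (`…_of_congr_sq`, «interior vertices: all `q²` grandchildren fixed»).  INVARIANT FORM (§4):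
through the modular neighbour `κ·N₁` the deep criterion reads **`γ·(κ·(N₁ ⊔ 𝒪w(a,b))) = κ·(…) ↔ |B₀(x, (γ − 1)x)| < |ϖ|`**, `x = κe₀` (★ `conj_mul_apply_two_zero_eq_B₀`:
`(κ⁻¹Mκ)₂₀ = B₀(κe₀, M·κe₀)` for unitary `κ`) — the certificate's «`d = 1`: `v̄ᵀ(ḠȲ)v̄ = 0`», with `Ȳ = (γ − 1)∕ϖ mod ϖ` and `v̄` the isotropic point of the neighbour; hence per
modular neighbour the children are ALL fixed or NONE (§4 `…_or_…`).  COUNTING the isotropic points `x̄` of the residual conic with `B̄₀(x̄, Ȳx̄) = 0` by the residual type of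
`Ȳ` is the finite-geometry sequel (★ `OrthogonalThreeSymmetricNilpotentOrbits*` currency) and is not done here.
HONEST LABEL: HC_CM is proved only modulo the 2 remaining named inputs (hLiu418 24832, h413 24833) until rung 0 closes; nothing printed is asserted here (elementary lattice
algebra over a valuation ring); «S3-ram» has no books consequence.

## References
* [BruhatTits1972] F. Bruhat, J. Tits, *Groupes réductifs sur un corps local I*, Publ. Math. IHÉS 41 (1972), §10 (lattice models; the star of a vertex = the residual building).
* [Tits1979] J. Tits, *Reductive groups over local fields*, PSPM 33.1 (1979), §3.5 (reduction mod `𝔭`: `K₀(1)` acts trivially on the star), §2.4 (ramified `U(3)`).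
* [Serre1980Trees] J.-P. Serre, *Trees* (1980), Ch. II §1.1 (neighbours of a lattice = lines of its reduction; balls fixed by congruence subgroups).
* [Jacobowitz1962] R. Jacobowitz, *Hermitian forms over local fields*, Amer. J. Math. 84 (1962), §4, §7–§8.
-/

set_option autoImplicit false

noncomputable section

open scoped Valued WithZero Matrix MatrixGroups

namespace Literature.NumberTheory.Automorphic.UnitaryLatticeTree

open Literature.NumberTheory.Automorphic Literature.NumberTheory.Automorphic.HermitianLattice

variable {K : Type*} [Field K] [Valued K ℤᵐ⁰] {σ : K →+* K} {ϖ : K}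

/-! ## §1 An element of `K₀` fixing `N₁` has a unit corner entry `γ₀₀` -/

/-- If `γ ∈ K₀ = U(σ,J₀) ∩ GL₃(𝒪)` fixes the standard type-two neighbour `N₁ = latt diag(1,1,ϖ)` then `|γ₀₀| = 1` (the fixed-star test ★ `mapGL_mul_N₁_eq_iff` at `κ = 1`:
`γe₀ ≡ c·e₀` for a unit `c`). [cite: Tits1979, §3.5] [cite: Serre1980Trees, II.1.1] -/
theorem v_apply_zero_zero_eq_one_of_mapGL_N₁_eq (hvσ : ∀ a, Valued.v (σ a) = Valued.v a) (hϖ : Valued.v ϖ = WithZero.exp (-1 : ℤ))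
    {γ : unitaryGroupOfForm σ ((StdForm.antidiagonal 3).over K)} (hγK : γ ∈ unitaryInt σ ((StdForm.antidiagonal 3).over K))
    (hγ : mapGL (γ : GL (Fin 3) K) (latt (Matrix.diagonal ![(1 : K), 1, ϖ])) = latt (Matrix.diagonal ![(1 : K), 1, ϖ])) :
    Valued.v (((γ : GL (Fin 3) K) : Matrix (Fin 3) (Fin 3) K) 0 0) = 1 := by
  have h1 : mapGL (γ : GL (Fin 3) K) (mapGL ((1 : unitaryGroupOfForm σ ((StdForm.antidiagonal 3).over K)) : GL (Fin 3) K) (latt (Matrix.diagonal ![(1 : K), 1, ϖ]))) =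
      mapGL ((1 : unitaryGroupOfForm σ ((StdForm.antidiagonal 3).over K)) : GL (Fin 3) K) (latt (Matrix.diagonal ![(1 : K), 1, ϖ])) := by
    rw [OneMemClass.coe_one, mapGL_one]; exact hγ
  obtain ⟨c, hc, hcol⟩ := (mapGL_mul_N₁_eq_iff hvσ hϖ hγK (Subgroup.one_mem _)).1 h1
  have h00 := hcol 0
  rw [OneMemClass.coe_one, Units.val_one, Matrix.mul_one, Matrix.one_apply_eq, mul_one] at h00
  rw [← hc]
  exact Valuation.map_eq_of_sub_lt _ (by rwa [hc])

/-! ## §2 The fixed-child criterion (σϖ-free): one residual linear condition on the lift -/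

/-- **THE FIXED-CHILD CRITERION.**  For `γ ∈ K₀` fixing `N₁` and a primitive vector `w(a,b) = (a∕ϖ, 0, b)` with `|a| = 1`, `|b| ≤ 1`:
`γ·(N₁ ⊔ 𝒪w(a,b)) = N₁ ⊔ 𝒪w(a,b) ↔ |ϖ⁻¹γ₂₀·a + (γ₂₂ − γ₀₀)·b| < 1` — ★ `mapGL_N₁_sup_span_vec_eq_iff_of_v` with its unit pinned to `c = γ₀₀` (its first congruence forces
`|c − γ₀₀| < 1`).  The three cases of the certificate engines' «O(1) residual fixed test» (`d = 0`: one linear condition on the lift; `d = 1`; `d ≥ 2`) are this line and §3.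
[cite: BruhatTits1972, §10] [cite: Tits1979, §3.5] [cite: Serre1980Trees, II.1.1] -/
theorem mapGL_N₁_sup_span_vec_eq_iff_v_lt (hvσ : ∀ a, Valued.v (σ a) = Valued.v a) (hϖ : Valued.v ϖ = WithZero.exp (-1 : ℤ))
    {γ : unitaryGroupOfForm σ ((StdForm.antidiagonal 3).over K)} (hγK : γ ∈ unitaryInt σ ((StdForm.antidiagonal 3).over K))
    (hγ : mapGL (γ : GL (Fin 3) K) (latt (Matrix.diagonal ![(1 : K), 1, ϖ])) = latt (Matrix.diagonal ![(1 : K), 1, ϖ]))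
    {a b : K} (ha : Valued.v a = 1) (hb : Valued.v b ≤ 1) :
    mapGL (γ : GL (Fin 3) K) (latt (Matrix.diagonal ![(1 : K), 1, ϖ]) ⊔ Submodule.span 𝒪[K] {(![a / ϖ, 0, b] : Fin 3 → K)}) =
        latt (Matrix.diagonal ![(1 : K), 1, ϖ]) ⊔ Submodule.span 𝒪[K] {(![a / ϖ, 0, b] : Fin 3 → K)} ↔
      Valued.v (ϖ⁻¹ * ((γ : GL (Fin 3) K) : Matrix (Fin 3) (Fin 3) K) 2 0 * a +
        (((γ : GL (Fin 3) K) : Matrix (Fin 3) (Fin 3) K) 2 2 - ((γ : GL (Fin 3) K) : Matrix (Fin 3) (Fin 3) K) 0 0) * b) < 1 := by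
  rw [mapGL_N₁_sup_span_vec_eq_iff_of_v hvσ hϖ γ hγ ha.le hb (Or.inl ha)]
  have hϖ1 : Valued.v ϖ < 1 := by rw [hϖ, ← WithZero.exp_zero]; exact WithZero.exp_lt_exp.2 (by norm_num)
  have h00 := v_apply_zero_zero_eq_one_of_mapGL_N₁_eq hvσ hϖ hγK hγ
  have hG := (mem_unitaryInt_iff.1 hγK).1
  -- the `ϖγ₀₂b` term is always small
  have hsmall : Valued.v (ϖ * ((γ : GL (Fin 3) K) : Matrix (Fin 3) (Fin 3) K) 0 2 * b) < 1 := by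
    rw [map_mul, map_mul]
    calc Valued.v ϖ * Valued.v (((γ : GL (Fin 3) K) : Matrix (Fin 3) (Fin 3) K) 0 2) * Valued.v b
        ≤ Valued.v ϖ * 1 * 1 := mul_le_mul' (mul_le_mul' le_rfl (hG 0 2)) hb
      _ < 1 := by rw [mul_one, mul_one]; exact hϖ1
  constructor
  · rintro ⟨c, hc, h1, h2⟩
    -- from the first congruence: `|γ₀₀ − c| < 1`
    have hG00c : Valued.v (((γ : GL (Fin 3) K) : Matrix (Fin 3) (Fin 3) K) 0 0 - c) < 1 := by
      have h : Valued.v ((((γ : GL (Fin 3) K) : Matrix (Fin 3) (Fin 3) K) 0 0 - c) * a) < 1 := by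
        have e : (((γ : GL (Fin 3) K) : Matrix (Fin 3) (Fin 3) K) 0 0 - c) * a =
            (((γ : GL (Fin 3) K) : Matrix (Fin 3) (Fin 3) K) 0 0 * a + ϖ * ((γ : GL (Fin 3) K) : Matrix (Fin 3) (Fin 3) K) 0 2 * b - c * a) -
              ϖ * ((γ : GL (Fin 3) K) : Matrix (Fin 3) (Fin 3) K) 0 2 * b := by ring
        rw [e]; exact Valuation.map_sub_lt _ h1 hsmall
      rwa [map_mul, ha, mul_one] at h
    have e : ϖ⁻¹ * ((γ : GL (Fin 3) K) : Matrix (Fin 3) (Fin 3) K) 2 0 * a +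
        (((γ : GL (Fin 3) K) : Matrix (Fin 3) (Fin 3) K) 2 2 - ((γ : GL (Fin 3) K) : Matrix (Fin 3) (Fin 3) K) 0 0) * b =
        (ϖ⁻¹ * ((γ : GL (Fin 3) K) : Matrix (Fin 3) (Fin 3) K) 2 0 * a + ((γ : GL (Fin 3) K) : Matrix (Fin 3) (Fin 3) K) 2 2 * b - c * b) +
          (c - ((γ : GL (Fin 3) K) : Matrix (Fin 3) (Fin 3) K) 0 0) * b := by ring
    rw [e]
    refine Valuation.map_add_lt _ h2 ?_
    rw [map_mul, Valuation.map_sub_swap]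
    calc Valued.v (((γ : GL (Fin 3) K) : Matrix (Fin 3) (Fin 3) K) 0 0 - c) * Valued.v b
        ≤ Valued.v (((γ : GL (Fin 3) K) : Matrix (Fin 3) (Fin 3) K) 0 0 - c) * 1 := mul_le_mul' le_rfl hb
      _ < 1 := by rw [mul_one]; exact hG00c
  · intro h
    refine ⟨((γ : GL (Fin 3) K) : Matrix (Fin 3) (Fin 3) K) 0 0, h00, ?_, ?_⟩
    · have e : ((γ : GL (Fin 3) K) : Matrix (Fin 3) (Fin 3) K) 0 0 * a + ϖ * ((γ : GL (Fin 3) K) : Matrix (Fin 3) (Fin 3) K) 0 2 * b -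
          ((γ : GL (Fin 3) K) : Matrix (Fin 3) (Fin 3) K) 0 0 * a = ϖ * ((γ : GL (Fin 3) K) : Matrix (Fin 3) (Fin 3) K) 0 2 * b := by ring
      rw [e]; exact hsmall
    · have e : ϖ⁻¹ * ((γ : GL (Fin 3) K) : Matrix (Fin 3) (Fin 3) K) 2 0 * a + ((γ : GL (Fin 3) K) : Matrix (Fin 3) (Fin 3) K) 2 2 * b -
          ((γ : GL (Fin 3) K) : Matrix (Fin 3) (Fin 3) K) 0 0 * b =
          ϖ⁻¹ * ((γ : GL (Fin 3) K) : Matrix (Fin 3) (Fin 3) K) 2 0 * a +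
            (((γ : GL (Fin 3) K) : Matrix (Fin 3) (Fin 3) K) 2 2 - ((γ : GL (Fin 3) K) : Matrix (Fin 3) (Fin 3) K) 0 0) * b := by ring
      rw [e]; exact h

/-- **LIFT-FREE FORM WHEN THE TWO CORNER RESIDUES AGREE** (`|γ₂₂ − γ₀₀| < 1`; e.g. `γ` RESIDUALLY UNIPOTENT — both corners are then `≡ 1` — which is the case of
every vertex met by a deep conjugacy class: the certificate's strata `bd`, `reg`, `1±`, `0` alike): `γ·(N₁ ⊔ 𝒪w(a,b)) = N₁ ⊔ 𝒪w(a,b) ↔ |ϖ⁻¹·γ₂₀| < 1`, independent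
of `(a, b)` — per type-two neighbour the `q` children are fixed together or not at all. [cite: BruhatTits1972, §10] [cite: Tits1979, §3.5] [cite: Serre1980Trees, II.1.1] -/
theorem mapGL_N₁_sup_span_vec_eq_iff_of_v_sub_lt (hvσ : ∀ a, Valued.v (σ a) = Valued.v a) (hϖ : Valued.v ϖ = WithZero.exp (-1 : ℤ))
    {γ : unitaryGroupOfForm σ ((StdForm.antidiagonal 3).over K)} (hγK : γ ∈ unitaryInt σ ((StdForm.antidiagonal 3).over K))
    (hγ : mapGL (γ : GL (Fin 3) K) (latt (Matrix.diagonal ![(1 : K), 1, ϖ])) = latt (Matrix.diagonal ![(1 : K), 1, ϖ]))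
    (hdiag : Valued.v (((γ : GL (Fin 3) K) : Matrix (Fin 3) (Fin 3) K) 2 2 - ((γ : GL (Fin 3) K) : Matrix (Fin 3) (Fin 3) K) 0 0) < 1)
    {a b : K} (ha : Valued.v a = 1) (hb : Valued.v b ≤ 1) :
    mapGL (γ : GL (Fin 3) K) (latt (Matrix.diagonal ![(1 : K), 1, ϖ]) ⊔ Submodule.span 𝒪[K] {(![a / ϖ, 0, b] : Fin 3 → K)}) = latt (Matrix.diagonal ![(1 : K), 1, ϖ]) ⊔ Submodule.span 𝒪[K] {(![a / ϖ, 0, b] : Fin 3 → K)} ↔ Valued.v (ϖ⁻¹ * ((γ : GL (Fin 3) K) : Matrix (Fin 3) (Fin 3) K) 2 0) < 1 := by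
  rw [mapGL_N₁_sup_span_vec_eq_iff_v_lt hvσ hϖ hγK hγ ha hb]
  have hd : Valued.v ((((γ : GL (Fin 3) K) : Matrix (Fin 3) (Fin 3) K) 2 2 - ((γ : GL (Fin 3) K) : Matrix (Fin 3) (Fin 3) K) 0 0) * b) < 1 := by
    rw [map_mul]
    calc Valued.v (((γ : GL (Fin 3) K) : Matrix (Fin 3) (Fin 3) K) 2 2 - ((γ : GL (Fin 3) K) : Matrix (Fin 3) (Fin 3) K) 0 0) * Valued.v b ≤ Valued.v (((γ : GL (Fin 3) K) : Matrix (Fin 3) (Fin 3) K) 2 2 - ((γ : GL (Fin 3) K) : Matrix (Fin 3) (Fin 3) K) 0 0) * 1 := mul_le_mul' le_rfl hb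
      _ < 1 := by rw [mul_one]; exact hdiag
  constructor
  · intro h
    have h' : Valued.v (ϖ⁻¹ * ((γ : GL (Fin 3) K) : Matrix (Fin 3) (Fin 3) K) 2 0 * a) < 1 := by
      have e : ϖ⁻¹ * ((γ : GL (Fin 3) K) : Matrix (Fin 3) (Fin 3) K) 2 0 * a = (ϖ⁻¹ * ((γ : GL (Fin 3) K) : Matrix (Fin 3) (Fin 3) K) 2 0 * a + (((γ : GL (Fin 3) K) : Matrix (Fin 3) (Fin 3) K) 2 2 - ((γ : GL (Fin 3) K) : Matrix (Fin 3) (Fin 3) K) 0 0) * b) - (((γ : GL (Fin 3) K) : Matrix (Fin 3) (Fin 3) K) 2 2 - ((γ : GL (Fin 3) K) : Matrix (Fin 3) (Fin 3) K) 0 0) * b := by ring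
      rw [e]; exact Valuation.map_sub_lt _ h hd
    rwa [map_mul, ha, mul_one] at h'
  · intro h
    refine Valuation.map_add_lt _ ?_ hd
    rwa [map_mul, ha, mul_one]

/-! ## §3 Deep elements: the criterion is independent of the lift -/

/-- `K₀(1)` fixes `N₁`: if `γ ∈ K₀` has `|γ_{ij} − δ_{ij}| < 1` for all `i, j` then `γ·N₁ = N₁` (★ `mapGL_mul_N₁_eq_of_congr_one` at `κ = 1`). [cite: Tits1979, §3.5] -/
theorem mapGL_N₁_eq_of_congr_one (hvσ : ∀ a, Valued.v (σ a) = Valued.v a) (hϖ : Valued.v ϖ = WithZero.exp (-1 : ℤ))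
    {γ : unitaryGroupOfForm σ ((StdForm.antidiagonal 3).over K)} (hγK : γ ∈ unitaryInt σ ((StdForm.antidiagonal 3).over K))
    (hγ1 : ∀ i j, Valued.v ((((γ : GL (Fin 3) K) : Matrix (Fin 3) (Fin 3) K) - 1) i j) < 1) :
    mapGL (γ : GL (Fin 3) K) (latt (Matrix.diagonal ![(1 : K), 1, ϖ])) = latt (Matrix.diagonal ![(1 : K), 1, ϖ]) := by
  have h := mapGL_mul_N₁_eq_of_congr_one hvσ hϖ hγK (Subgroup.one_mem _) hγ1
  rwa [OneMemClass.coe_one, mapGL_one] at h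

/-- **DEEP ELEMENTS: THE `q` LIFTS ARE FIXED TOGETHER.**  If `γ ∈ K₀` is `≡ 1 (mod ϖ)` entrywise (`|γ_{ij} − δ_{ij}| ≤ |ϖ|`) then for every primitive `w(a,b)`,
`|a| = 1`, `|b| ≤ 1`: `γ·(N₁ ⊔ 𝒪w(a,b)) = N₁ ⊔ 𝒪w(a,b) ↔ |ϖ⁻¹·γ₂₀| < 1` — INDEPENDENT of `(a, b)` (the certificate's «`d = 1`» clause; for `d ≥ 2` see
`…_of_congr_sq`). [cite: Tits1979, §3.5] [cite: BruhatTits1972, §10] [cite: Serre1980Trees, II.1.1] -/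
theorem mapGL_N₁_sup_span_vec_eq_iff_of_congr (hvσ : ∀ a, Valued.v (σ a) = Valued.v a) (hϖ : Valued.v ϖ = WithZero.exp (-1 : ℤ))
    {γ : unitaryGroupOfForm σ ((StdForm.antidiagonal 3).over K)} (hγK : γ ∈ unitaryInt σ ((StdForm.antidiagonal 3).over K))
    (hγϖ : ∀ i j, Valued.v ((((γ : GL (Fin 3) K) : Matrix (Fin 3) (Fin 3) K) - 1) i j) ≤ Valued.v ϖ)
    {a b : K} (ha : Valued.v a = 1) (hb : Valued.v b ≤ 1) :
    mapGL (γ : GL (Fin 3) K) (latt (Matrix.diagonal ![(1 : K), 1, ϖ]) ⊔ Submodule.span 𝒪[K] {(![a / ϖ, 0, b] : Fin 3 → K)}) =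
        latt (Matrix.diagonal ![(1 : K), 1, ϖ]) ⊔ Submodule.span 𝒪[K] {(![a / ϖ, 0, b] : Fin 3 → K)} ↔
      Valued.v (ϖ⁻¹ * ((γ : GL (Fin 3) K) : Matrix (Fin 3) (Fin 3) K) 2 0) < 1 := by
  have hϖ1 : Valued.v ϖ < 1 := by rw [hϖ, ← WithZero.exp_zero]; exact WithZero.exp_lt_exp.2 (by norm_num)
  have hγ1 : ∀ i j, Valued.v ((((γ : GL (Fin 3) K) : Matrix (Fin 3) (Fin 3) K) - 1) i j) < 1 := fun i j => (hγϖ i j).trans_lt hϖ1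
  rw [mapGL_N₁_sup_span_vec_eq_iff_v_lt hvσ hϖ hγK (mapGL_N₁_eq_of_congr_one hvσ hϖ hγK hγ1) ha hb]
  -- the diagonal difference is `≡ 0 (mod ϖ)`
  have hd : Valued.v ((((γ : GL (Fin 3) K) : Matrix (Fin 3) (Fin 3) K) 2 2 - ((γ : GL (Fin 3) K) : Matrix (Fin 3) (Fin 3) K) 0 0) * b) < 1 := by
    have e : ((γ : GL (Fin 3) K) : Matrix (Fin 3) (Fin 3) K) 2 2 - ((γ : GL (Fin 3) K) : Matrix (Fin 3) (Fin 3) K) 0 0 =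
        (((γ : GL (Fin 3) K) : Matrix (Fin 3) (Fin 3) K) - 1) 2 2 - (((γ : GL (Fin 3) K) : Matrix (Fin 3) (Fin 3) K) - 1) 0 0 := by
      simp only [Matrix.sub_apply, Matrix.one_apply_eq]; ring
    rw [map_mul, e]
    calc Valued.v ((((γ : GL (Fin 3) K) : Matrix (Fin 3) (Fin 3) K) - 1) 2 2 - (((γ : GL (Fin 3) K) : Matrix (Fin 3) (Fin 3) K) - 1) 0 0) * Valued.v b
        ≤ Valued.v ((((γ : GL (Fin 3) K) : Matrix (Fin 3) (Fin 3) K) - 1) 2 2 - (((γ : GL (Fin 3) K) : Matrix (Fin 3) (Fin 3) K) - 1) 0 0) * 1 := mul_le_mul' le_rfl hb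
      _ < 1 := by rw [mul_one]; exact Valuation.map_sub_lt _ (hγ1 2 2) (hγ1 0 0)
  constructor
  · intro h
    have h' : Valued.v (ϖ⁻¹ * ((γ : GL (Fin 3) K) : Matrix (Fin 3) (Fin 3) K) 2 0 * a) < 1 := by
      have e : ϖ⁻¹ * ((γ : GL (Fin 3) K) : Matrix (Fin 3) (Fin 3) K) 2 0 * a =
          (ϖ⁻¹ * ((γ : GL (Fin 3) K) : Matrix (Fin 3) (Fin 3) K) 2 0 * a +
            (((γ : GL (Fin 3) K) : Matrix (Fin 3) (Fin 3) K) 2 2 - ((γ : GL (Fin 3) K) : Matrix (Fin 3) (Fin 3) K) 0 0) * b) -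
            (((γ : GL (Fin 3) K) : Matrix (Fin 3) (Fin 3) K) 2 2 - ((γ : GL (Fin 3) K) : Matrix (Fin 3) (Fin 3) K) 0 0) * b := by ring
      rw [e]; exact Valuation.map_sub_lt _ h hd
    rwa [map_mul, ha, mul_one] at h'
  · intro h
    refine Valuation.map_add_lt _ ?_ hd
    rwa [map_mul, ha, mul_one]

/-- **INTERIOR ELEMENTS: ALL `q²` GRANDCHILDREN FIXED.**  If `γ ∈ K₀` is `≡ 1 (mod ϖ²)` entrywise then `γ` fixes every `N₁ ⊔ 𝒪w(a,b)` (and, by ★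
`mapGL_mul_N₁_eq_of_congr_one`, every type-two neighbour) — the certificate's «`d ≥ 2`» clause. [cite: Tits1979, §3.5] [cite: Serre1980Trees, II.1.1] -/
theorem mapGL_N₁_sup_span_vec_eq_of_congr_sq (hvσ : ∀ a, Valued.v (σ a) = Valued.v a) (hϖ : Valued.v ϖ = WithZero.exp (-1 : ℤ))
    {γ : unitaryGroupOfForm σ ((StdForm.antidiagonal 3).over K)} (hγK : γ ∈ unitaryInt σ ((StdForm.antidiagonal 3).over K))
    (hγϖ2 : ∀ i j, Valued.v ((((γ : GL (Fin 3) K) : Matrix (Fin 3) (Fin 3) K) - 1) i j) ≤ Valued.v ϖ ^ 2)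
    {a b : K} (ha : Valued.v a = 1) (hb : Valued.v b ≤ 1) :
    mapGL (γ : GL (Fin 3) K) (latt (Matrix.diagonal ![(1 : K), 1, ϖ]) ⊔ Submodule.span 𝒪[K] {(![a / ϖ, 0, b] : Fin 3 → K)}) =
      latt (Matrix.diagonal ![(1 : K), 1, ϖ]) ⊔ Submodule.span 𝒪[K] {(![a / ϖ, 0, b] : Fin 3 → K)} := by
  have hϖ0 : ϖ ≠ 0 := fun h0 => by rw [h0, map_zero] at hϖ; exact WithZero.coe_ne_zero hϖ.symm
  have hϖ1 : Valued.v ϖ < 1 := by rw [hϖ, ← WithZero.exp_zero]; exact WithZero.exp_lt_exp.2 (by norm_num)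
  have hϖle : ∀ i j, Valued.v ((((γ : GL (Fin 3) K) : Matrix (Fin 3) (Fin 3) K) - 1) i j) ≤ Valued.v ϖ := fun i j =>
    (hγϖ2 i j).trans (by rw [sq]; exact mul_le_of_le_one_left' hϖ1.le)
  refine (mapGL_N₁_sup_span_vec_eq_iff_of_congr hvσ hϖ hγK hϖle ha hb).2 ?_
  have h20 : ((γ : GL (Fin 3) K) : Matrix (Fin 3) (Fin 3) K) 2 0 = (((γ : GL (Fin 3) K) : Matrix (Fin 3) (Fin 3) K) - 1) 2 0 := by
    simp only [Matrix.sub_apply, Matrix.one_apply_ne (by decide : (2 : Fin 3) ≠ 0), sub_zero]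
  rw [map_mul, map_inv₀, h20]
  calc (Valued.v ϖ)⁻¹ * Valued.v ((((γ : GL (Fin 3) K) : Matrix (Fin 3) (Fin 3) K) - 1) 2 0)
      ≤ (Valued.v ϖ)⁻¹ * Valued.v ϖ ^ 2 := mul_le_mul' le_rfl (hγϖ2 2 0)
    _ = Valued.v ϖ := by rw [sq, ← mul_assoc, inv_mul_cancel₀ ((Valuation.ne_zero_iff _).2 hϖ0), one_mul]
    _ < 1 := hϖ1


/-! ## §4 Through a type-two neighbour `κ·N₁`: the invariant form `|B₀(x, (γ − 1)x)| < |ϖ|`, `x = κe₀` -/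

/-- **Fixed translates = fixed points of the conjugate**: `g·(u·S) = u·S ↔ (u⁻¹gu)·S = S` for lattices `S ⊆ K^N` (any rank; how a fixed vertex `u·L₀` and its children are
read at the root). [cite: Serre1980Trees, II.1.1] [cite: BruhatTits1972, §10] -/
theorem mapGL_mapGL_eq_iff_mapGL_conj_eq {N : ℕ} (g u : GL (Fin N) K) (S : Submodule 𝒪[K] (Fin N → K)) :
    mapGL g (mapGL u S) = mapGL u S ↔ mapGL (u⁻¹ * g * u) S = S := by
  rw [mapGL_mul, mapGL_mul]
  constructor
  · intro h; rw [h, ← mapGL_mul, inv_mul_cancel, mapGL_one]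
  · intro h
    have h' := congrArg (mapGL u) h
    rwa [← mapGL_mul, mul_inv_cancel, mapGL_one] at h'

omit [Valued K ℤᵐ⁰] in
/-- **`(κ⁻¹ M κ)₂₀ = B₀(κe₀, M·κe₀)` for unitary `κ`** (`B₀(κe₀, κy) = B₀(e₀, y) = y₂`): the corner entry after conjugation is the value of the form on the isotropic
vector `x = κe₀` of the type-two neighbour `κ·N₁` — the bridge from coordinates to the certificate's `v̄ᵀ(ḠȲ)v̄`. [cite: BruhatTits1972, §10] [cite: Jacobowitz1962, §4] -/
theorem inv_mul_mul_apply_two_zero_eq_B₀ (κ : unitaryGroupOfForm σ ((StdForm.antidiagonal 3).over K)) (M : Matrix (Fin 3) (Fin 3) K) :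
    ((((κ : GL (Fin 3) K)⁻¹ : GL (Fin 3) K) : Matrix (Fin 3) (Fin 3) K) * M * ((κ : GL (Fin 3) K) : Matrix (Fin 3) (Fin 3) K)) 2 0 = B₀ σ 3 (fun i => ((κ : GL (Fin 3) K) : Matrix (Fin 3) (Fin 3) K) i 0) (M.mulVec (fun i => ((κ : GL (Fin 3) K) : Matrix (Fin 3) (Fin 3) K) i 0)) := by
  have hκu := (mem_unitaryGroupOfForm_antidiagonal_iff (κ : GL (Fin 3) K)).1 κ.2
  have hx : (fun i => ((κ : GL (Fin 3) K) : Matrix (Fin 3) (Fin 3) K) i 0) = ((κ : GL (Fin 3) K) : Matrix (Fin 3) (Fin 3) K).mulVec (Pi.single 0 1) := by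
    ext i
    rw [Matrix.mulVec, dotProduct, Finset.sum_eq_single (0 : Fin 3)]
    · rw [Pi.single_eq_same, mul_one]
    · intro j _ hj; rw [Pi.single_eq_of_ne hj, mul_zero]
    · intro h; exact absurd (Finset.mem_univ _) h
  have hM : M * ((κ : GL (Fin 3) K) : Matrix (Fin 3) (Fin 3) K) = ((κ : GL (Fin 3) K) : Matrix (Fin 3) (Fin 3) K) * ((((κ : GL (Fin 3) K)⁻¹ : GL (Fin 3) K) : Matrix (Fin 3) (Fin 3) K) * M * ((κ : GL (Fin 3) K) : Matrix (Fin 3) (Fin 3) K)) := by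
    rw [← Matrix.mul_assoc, ← Matrix.mul_assoc, Units.mul_inv, Matrix.one_mul]
  rw [hx, Matrix.mulVec_mulVec, hM, ← Matrix.mulVec_mulVec, hκu, B₀_single_left, Matrix.mulVec, dotProduct, Finset.sum_eq_single (0 : Fin 3)]
  · rw [Pi.single_eq_same, mul_one]; rfl
  · intro j _ hj; rw [Pi.single_eq_of_ne hj, mul_zero]
  · intro h; exact absurd (Finset.mem_univ _) h

omit [Valued K ℤᵐ⁰] in
/-- `κ⁻¹γκ − 1 = κ⁻¹(γ − 1)κ` on matrices. [cite: Tits1979, §3.5] -/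
theorem coe_inv_mul_mul_sub_one (γ κ : unitaryGroupOfForm σ ((StdForm.antidiagonal 3).over K)) :
    (((κ⁻¹ * γ * κ : unitaryGroupOfForm σ ((StdForm.antidiagonal 3).over K)) : GL (Fin 3) K) : Matrix (Fin 3) (Fin 3) K) - 1 = (((κ : GL (Fin 3) K)⁻¹ : GL (Fin 3) K) : Matrix (Fin 3) (Fin 3) K) * (((γ : GL (Fin 3) K) : Matrix (Fin 3) (Fin 3) K) - 1) * ((κ : GL (Fin 3) K) : Matrix (Fin 3) (Fin 3) K) := by
  rw [Matrix.mul_sub, Matrix.sub_mul, Matrix.mul_one, Units.inv_mul, Subgroup.coe_mul, Subgroup.coe_mul, Subgroup.coe_inv, Units.val_mul, Units.val_mul]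

/-- Conjugation by `κ ∈ K₀` keeps `≡ 1 (mod ϖ)`: the entries of `κ⁻¹γκ − 1 = κ⁻¹(γ − 1)κ` are bounded by `|ϖ|` when those of `γ − 1` are. [cite: Tits1979, §3.5] -/
theorem v_inv_mul_mul_sub_one_apply_le {γ κ : unitaryGroupOfForm σ ((StdForm.antidiagonal 3).over K)} (hκK : κ ∈ unitaryInt σ ((StdForm.antidiagonal 3).over K))
    (hγϖ : ∀ i j, Valued.v ((((γ : GL (Fin 3) K) : Matrix (Fin 3) (Fin 3) K) - 1) i j) ≤ Valued.v ϖ) (i j : Fin 3) :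
    Valued.v (((((κ⁻¹ * γ * κ : unitaryGroupOfForm σ ((StdForm.antidiagonal 3).over K)) : GL (Fin 3) K) : Matrix (Fin 3) (Fin 3) K) - 1) i j) ≤ Valued.v ϖ := by
  have hK := (mem_unitaryInt_iff.1 hκK).1
  have hKi := (mem_unitaryInt_iff.1 hκK).2
  rw [coe_inv_mul_mul_sub_one, Matrix.mul_apply]
  refine Valuation.map_sum_le _ fun m _ => ?_
  rw [map_mul, Matrix.mul_apply]
  calc Valued.v (∑ l, (((κ : GL (Fin 3) K)⁻¹ : GL (Fin 3) K) : Matrix (Fin 3) (Fin 3) K) i l * (((γ : GL (Fin 3) K) : Matrix (Fin 3) (Fin 3) K) - 1) l m) * Valued.v (((κ : GL (Fin 3) K) : Matrix (Fin 3) (Fin 3) K) m j)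
      ≤ Valued.v ϖ * 1 := mul_le_mul' (Valuation.map_sum_le _ fun l _ => by
          rw [map_mul]
          calc Valued.v ((((κ : GL (Fin 3) K)⁻¹ : GL (Fin 3) K) : Matrix (Fin 3) (Fin 3) K) i l) * Valued.v ((((γ : GL (Fin 3) K) : Matrix (Fin 3) (Fin 3) K) - 1) l m) ≤ 1 * Valued.v ϖ := mul_le_mul' (hKi i l) (hγϖ l m)
            _ = Valued.v ϖ := one_mul _) (hK m j)
    _ = Valued.v ϖ := mul_one _

/-- **THE DEEP FIXED-CHILD CRITERION THROUGH A TYPE-TWO NEIGHBOUR.**  For `γ, κ ∈ K₀` with `γ ≡ 1 (mod ϖ)` entrywise and a primitive `w(a,b)` (`|a| = 1`, `|b| ≤ 1`):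
`γ·(κ·(N₁ ⊔ 𝒪w(a,b))) = κ·(N₁ ⊔ 𝒪w(a,b)) ↔ |ϖ⁻¹·B₀(x, (γ − 1)x)| < 1`, `x = κe₀` the isotropic vector of `κ·N₁` — the certificate's «`d = 1`: `v̄ᵀ(ḠȲ)v̄ = 0`», `Ȳ = (γ−1)∕ϖ`,
independent of the lift. [cite: BruhatTits1972, §10] [cite: Tits1979, §3.5] [cite: Serre1980Trees, II.1.1] -/
theorem mapGL_mapGL_N₁_sup_span_vec_eq_iff_of_congr (hvσ : ∀ a, Valued.v (σ a) = Valued.v a) (hϖ : Valued.v ϖ = WithZero.exp (-1 : ℤ))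
    {γ κ : unitaryGroupOfForm σ ((StdForm.antidiagonal 3).over K)} (hγK : γ ∈ unitaryInt σ ((StdForm.antidiagonal 3).over K)) (hκK : κ ∈ unitaryInt σ ((StdForm.antidiagonal 3).over K))
    (hγϖ : ∀ i j, Valued.v ((((γ : GL (Fin 3) K) : Matrix (Fin 3) (Fin 3) K) - 1) i j) ≤ Valued.v ϖ)
    {a b : K} (ha : Valued.v a = 1) (hb : Valued.v b ≤ 1) :
    mapGL (γ : GL (Fin 3) K) (mapGL (κ : GL (Fin 3) K) (latt (Matrix.diagonal ![(1 : K), 1, ϖ]) ⊔ Submodule.span 𝒪[K] {(![a / ϖ, 0, b] : Fin 3 → K)})) = mapGL (κ : GL (Fin 3) K) (latt (Matrix.diagonal ![(1 : K), 1, ϖ]) ⊔ Submodule.span 𝒪[K] {(![a / ϖ, 0, b] : Fin 3 → K)}) ↔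
      Valued.v (ϖ⁻¹ * B₀ σ 3 (fun i => ((κ : GL (Fin 3) K) : Matrix (Fin 3) (Fin 3) K) i 0) ((((γ : GL (Fin 3) K) : Matrix (Fin 3) (Fin 3) K) - 1).mulVec (fun i => ((κ : GL (Fin 3) K) : Matrix (Fin 3) (Fin 3) K) i 0))) < 1 := by
  -- conjugate: `γ·(κ·S) = κ·S ↔ (κ⁻¹γκ)·S = S`
  have hconj : mapGL (γ : GL (Fin 3) K) (mapGL (κ : GL (Fin 3) K) (latt (Matrix.diagonal ![(1 : K), 1, ϖ]) ⊔ Submodule.span 𝒪[K] {(![a / ϖ, 0, b] : Fin 3 → K)})) = mapGL (κ : GL (Fin 3) K) (latt (Matrix.diagonal ![(1 : K), 1, ϖ]) ⊔ Submodule.span 𝒪[K] {(![a / ϖ, 0, b] : Fin 3 → K)}) ↔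
      mapGL ((κ⁻¹ * γ * κ : unitaryGroupOfForm σ ((StdForm.antidiagonal 3).over K)) : GL (Fin 3) K) (latt (Matrix.diagonal ![(1 : K), 1, ϖ]) ⊔ Submodule.span 𝒪[K] {(![a / ϖ, 0, b] : Fin 3 → K)}) = latt (Matrix.diagonal ![(1 : K), 1, ϖ]) ⊔ Submodule.span 𝒪[K] {(![a / ϖ, 0, b] : Fin 3 → K)} := by
    rw [Subgroup.coe_mul, Subgroup.coe_mul, Subgroup.coe_inv]
    exact mapGL_mapGL_eq_iff_mapGL_conj_eq _ _ _
  rw [hconj, mapGL_N₁_sup_span_vec_eq_iff_of_congr hvσ hϖ (Subgroup.mul_mem _ (Subgroup.mul_mem _ (Subgroup.inv_mem _ hκK) hγK) hκK)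
    (v_inv_mul_mul_sub_one_apply_le hκK hγϖ) ha hb]
  -- `(κ⁻¹γκ)₂₀ = (κ⁻¹(γ−1)κ)₂₀ = B₀(x, (γ−1)x)`
  have h20 : (((κ⁻¹ * γ * κ : unitaryGroupOfForm σ ((StdForm.antidiagonal 3).over K)) : GL (Fin 3) K) : Matrix (Fin 3) (Fin 3) K) 2 0 = ((((κ⁻¹ * γ * κ : unitaryGroupOfForm σ ((StdForm.antidiagonal 3).over K)) : GL (Fin 3) K) : Matrix (Fin 3) (Fin 3) K) - 1) 2 0 := by
    rw [Matrix.sub_apply, Matrix.one_apply_ne (by decide : (2 : Fin 3) ≠ 0), sub_zero]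
  rw [h20, coe_inv_mul_mul_sub_one, inv_mul_mul_apply_two_zero_eq_B₀]

/-- **PER TYPE-TWO NEIGHBOUR THE CHILDREN ARE ALL FIXED OR NONE** (deep `γ`): since the criterion does not see the lift, `γ` fixes every `κ·(N₁ ⊔ 𝒪w(a,b))` with `|a| = 1` or fixes
none of them.  At a tamely ramified place these are ALL the self-dual neighbours of `κ·N₁` other than `L₀` (★ `mem_neighborSet_N₁_iff_exists_vec_of_neg`), so the fixed part of
the distance-2 sphere below `L₀` is a union of whole stars — `q` vertices per isotropic point `x̄` of the residual conic with `B̄₀(x̄, Ȳx̄) = 0`. [cite: Tits1979, §3.5; §2.4]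
[cite: Serre1980Trees, II.1.1] -/
theorem forall_mapGL_mapGL_N₁_sup_span_vec_eq_or_forall_ne (hvσ : ∀ a, Valued.v (σ a) = Valued.v a) (hϖ : Valued.v ϖ = WithZero.exp (-1 : ℤ))
    {γ κ : unitaryGroupOfForm σ ((StdForm.antidiagonal 3).over K)} (hγK : γ ∈ unitaryInt σ ((StdForm.antidiagonal 3).over K)) (hκK : κ ∈ unitaryInt σ ((StdForm.antidiagonal 3).over K))
    (hγϖ : ∀ i j, Valued.v ((((γ : GL (Fin 3) K) : Matrix (Fin 3) (Fin 3) K) - 1) i j) ≤ Valued.v ϖ) :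
    (∀ a b : K, Valued.v a = 1 → Valued.v b ≤ 1 →
      mapGL (γ : GL (Fin 3) K) (mapGL (κ : GL (Fin 3) K) (latt (Matrix.diagonal ![(1 : K), 1, ϖ]) ⊔ Submodule.span 𝒪[K] {(![a / ϖ, 0, b] : Fin 3 → K)})) = mapGL (κ : GL (Fin 3) K) (latt (Matrix.diagonal ![(1 : K), 1, ϖ]) ⊔ Submodule.span 𝒪[K] {(![a / ϖ, 0, b] : Fin 3 → K)})) ∨
    (∀ a b : K, Valued.v a = 1 → Valued.v b ≤ 1 →
      mapGL (γ : GL (Fin 3) K) (mapGL (κ : GL (Fin 3) K) (latt (Matrix.diagonal ![(1 : K), 1, ϖ]) ⊔ Submodule.span 𝒪[K] {(![a / ϖ, 0, b] : Fin 3 → K)})) ≠ mapGL (κ : GL (Fin 3) K) (latt (Matrix.diagonal ![(1 : K), 1, ϖ]) ⊔ Submodule.span 𝒪[K] {(![a / ϖ, 0, b] : Fin 3 → K)})) := by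
  by_cases h : Valued.v (ϖ⁻¹ * B₀ σ 3 (fun i => ((κ : GL (Fin 3) K) : Matrix (Fin 3) (Fin 3) K) i 0) ((((γ : GL (Fin 3) K) : Matrix (Fin 3) (Fin 3) K) - 1).mulVec (fun i => ((κ : GL (Fin 3) K) : Matrix (Fin 3) (Fin 3) K) i 0))) < 1
  · exact Or.inl fun a b ha hb => (mapGL_mapGL_N₁_sup_span_vec_eq_iff_of_congr hvσ hϖ hγK hκK hγϖ ha hb).2 h
  · exact Or.inr fun a b ha hb hfix => h ((mapGL_mapGL_N₁_sup_span_vec_eq_iff_of_congr hvσ hϖ hγK hκK hγϖ ha hb).1 hfix)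

/-- The type-two neighbour `κ·N₁` itself is fixed by a deep `γ` (★ `mapGL_mul_N₁_eq_of_congr_one`, restated in the `≡ 1 (mod ϖ)` currency of this file). [cite: Tits1979, §3.5] -/
theorem mapGL_mapGL_N₁_eq_of_congr (hvσ : ∀ a, Valued.v (σ a) = Valued.v a) (hϖ : Valued.v ϖ = WithZero.exp (-1 : ℤ))
    {γ κ : unitaryGroupOfForm σ ((StdForm.antidiagonal 3).over K)} (hγK : γ ∈ unitaryInt σ ((StdForm.antidiagonal 3).over K)) (hκK : κ ∈ unitaryInt σ ((StdForm.antidiagonal 3).over K))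
    (hγϖ : ∀ i j, Valued.v ((((γ : GL (Fin 3) K) : Matrix (Fin 3) (Fin 3) K) - 1) i j) ≤ Valued.v ϖ) :
    mapGL (γ : GL (Fin 3) K) (mapGL (κ : GL (Fin 3) K) (latt (Matrix.diagonal ![(1 : K), 1, ϖ]))) = mapGL (κ : GL (Fin 3) K) (latt (Matrix.diagonal ![(1 : K), 1, ϖ])) := by
  have hϖ1 : Valued.v ϖ < 1 := by rw [hϖ, ← WithZero.exp_zero]; exact WithZero.exp_lt_exp.2 (by norm_num)
  exact mapGL_mul_N₁_eq_of_congr_one hvσ hϖ hγK hκK fun i j => (hγϖ i j).trans_lt hϖ1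

/-- **THE LIFT-FREE CRITERION THROUGH A TYPE-TWO NEIGHBOUR, INVARIANT FORM** (all residual types at once): for `γ, κ ∈ K₀` with `γ·(κ·N₁) = κ·N₁` and the two corner
residues of `κ⁻¹γκ` equal (`|(κ⁻¹γκ)₂₂ − (κ⁻¹γκ)₀₀| < 1`, e.g. `γ` residually unipotent): `γ·(κ·(N₁ ⊔ 𝒪w(a,b))) = κ·(…) ↔ |ϖ⁻¹·B₀(x, γx)| < 1`, `x = κe₀` the isotropic
vector of the neighbour (`(κ⁻¹γκ)₂₀ = B₀(x, γx)` by `inv_mul_mul_apply_two_zero_eq_B₀`; for deep `γ` this is `B₀(x, (γ−1)x)` since `B₀(x,x) ≡ 0`). [cite: BruhatTits1972, §10]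
[cite: Tits1979, §3.5] [cite: Serre1980Trees, II.1.1] -/
theorem mapGL_mapGL_N₁_sup_span_vec_eq_iff_of_v_sub_lt (hvσ : ∀ a, Valued.v (σ a) = Valued.v a) (hϖ : Valued.v ϖ = WithZero.exp (-1 : ℤ))
    {γ κ : unitaryGroupOfForm σ ((StdForm.antidiagonal 3).over K)} (hγK : γ ∈ unitaryInt σ ((StdForm.antidiagonal 3).over K)) (hκK : κ ∈ unitaryInt σ ((StdForm.antidiagonal 3).over K))
    (hγκ : mapGL (γ : GL (Fin 3) K) (mapGL (κ : GL (Fin 3) K) (latt (Matrix.diagonal ![(1 : K), 1, ϖ]))) = mapGL (κ : GL (Fin 3) K) (latt (Matrix.diagonal ![(1 : K), 1, ϖ])))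
    (hdiag : Valued.v ((((κ⁻¹ * γ * κ : unitaryGroupOfForm σ ((StdForm.antidiagonal 3).over K)) : GL (Fin 3) K) : Matrix (Fin 3) (Fin 3) K) 2 2 - (((κ⁻¹ * γ * κ : unitaryGroupOfForm σ ((StdForm.antidiagonal 3).over K)) : GL (Fin 3) K) : Matrix (Fin 3) (Fin 3) K) 0 0) < 1)
    {a b : K} (ha : Valued.v a = 1) (hb : Valued.v b ≤ 1) :
    mapGL (γ : GL (Fin 3) K) (mapGL (κ : GL (Fin 3) K) (latt (Matrix.diagonal ![(1 : K), 1, ϖ]) ⊔ Submodule.span 𝒪[K] {(![a / ϖ, 0, b] : Fin 3 → K)})) = mapGL (κ : GL (Fin 3) K) (latt (Matrix.diagonal ![(1 : K), 1, ϖ]) ⊔ Submodule.span 𝒪[K] {(![a / ϖ, 0, b] : Fin 3 → K)}) ↔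
      Valued.v (ϖ⁻¹ * B₀ σ 3 (fun i => ((κ : GL (Fin 3) K) : Matrix (Fin 3) (Fin 3) K) i 0) (((γ : GL (Fin 3) K) : Matrix (Fin 3) (Fin 3) K).mulVec (fun i => ((κ : GL (Fin 3) K) : Matrix (Fin 3) (Fin 3) K) i 0))) < 1 := by
  have hconj : mapGL (γ : GL (Fin 3) K) (mapGL (κ : GL (Fin 3) K) (latt (Matrix.diagonal ![(1 : K), 1, ϖ]) ⊔ Submodule.span 𝒪[K] {(![a / ϖ, 0, b] : Fin 3 → K)})) = mapGL (κ : GL (Fin 3) K) (latt (Matrix.diagonal ![(1 : K), 1, ϖ]) ⊔ Submodule.span 𝒪[K] {(![a / ϖ, 0, b] : Fin 3 → K)}) ↔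
      mapGL ((κ⁻¹ * γ * κ : unitaryGroupOfForm σ ((StdForm.antidiagonal 3).over K)) : GL (Fin 3) K) (latt (Matrix.diagonal ![(1 : K), 1, ϖ]) ⊔ Submodule.span 𝒪[K] {(![a / ϖ, 0, b] : Fin 3 → K)}) = latt (Matrix.diagonal ![(1 : K), 1, ϖ]) ⊔ Submodule.span 𝒪[K] {(![a / ϖ, 0, b] : Fin 3 → K)} := by
    rw [Subgroup.coe_mul, Subgroup.coe_mul, Subgroup.coe_inv]
    exact mapGL_mapGL_eq_iff_mapGL_conj_eq _ _ _
  have hγ' : mapGL ((κ⁻¹ * γ * κ : unitaryGroupOfForm σ ((StdForm.antidiagonal 3).over K)) : GL (Fin 3) K) (latt (Matrix.diagonal ![(1 : K), 1, ϖ])) = latt (Matrix.diagonal ![(1 : K), 1, ϖ]) := by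
    rw [Subgroup.coe_mul, Subgroup.coe_mul, Subgroup.coe_inv]
    exact (mapGL_mapGL_eq_iff_mapGL_conj_eq _ _ _).1 hγκ
  rw [hconj, mapGL_N₁_sup_span_vec_eq_iff_of_v_sub_lt hvσ hϖ (Subgroup.mul_mem _ (Subgroup.mul_mem _ (Subgroup.inv_mem _ hκK) hγK) hκK) hγ' hdiag ha hb,
    Subgroup.coe_mul, Subgroup.coe_mul, Subgroup.coe_inv, Units.val_mul, Units.val_mul, inv_mul_mul_apply_two_zero_eq_B₀]

end Literature.NumberTheory.Automorphic.UnitaryLatticeTree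

end
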